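import Literature.Computability.Cryptography.RegevSamplerMachinePar
import Literature.Computability.Cryptography.RegevSamplerStageDesc
import Literature.Computability.Cryptography.RegevSamplerEraseDesc
import Literature.Computability.Cryptography.RegevSamplerOracleDesc
import Literature.Computability.QuantumComplexity.TidyDesc
import Literature.Computability.QuantumComplexity.CleanXorAbstract
import HarnessLib

/-!
# Regev 2009, Lemma 3.14 in machine form: the abstract gate list of the data-free machine circuit

Topic `Computability/Cryptography` (family `pqc`), grouping namespace `Regev2009.SamplerRegs`; the CONCATENATION step of
the uniformity proof of the inner machine (the machine circuit `machineCircPar` of `RegevSamplerMachinePar.lean` is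
GR stage · erase layer · oracle stage · Fourier stage). On the standard objects (`stdEmb`, `srcU`, `stdZone`, any
layout with `loc = id`, e.g. `stdLayout`/`schedLayout`) the abstract gate list (`AJLCore.toAG`) of the machine circuit
is, by the stage lemmas already in the tree —

* `map_toAG_grStage_std` (`RegevSamplerStageDesc.lean`): the Grover–Rudolph stage = `n` copies of the block word under
  the affine wire maps `embA 0 ℓ base B i`;
* `map_toAG_cnotLayer_par` (`RegevSamplerEraseDesc.lean`): the erase layer = the CNOT double loop `eraseA`;
* `SamplerSubst.map_toAG_stageCirc_std` (`RegevSamplerOracleDesc.lean`) with `TidyBlockFn.map_toAG_tidyCirc`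
  (`TidyDesc.lean`): the oracle stage = `Y ++ S ++ T̂ ++ X ++ T̂`, `T̂` = the abstract tidy block `tidyA` of the
  oracle solver's own word under `subA`;
* `map_toAG_qftStage_std`: the Fourier stage = `n` copies of the QFT block word under `embA oS ℓR base qbsize i` —

the explicit concatenation **`map_toAG_machineCircPar_std`**; and the three classical blocks are abstract compiled words
of relabelled clean blocks and XOR layers (**`map_toAG_circY`**, **`map_toAG_circS`**, **`map_toAG_circX`**, from
`CleanXor.map_toAG_circuit`). What then remains for `QCircuitFamily.isUniform_of_abstract` is to compute on codes the
GR and QFT BLOCK words, the clean-block words `progA (cleanOps e M N [])` and the suffix/XOR layers, and the oracle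
solver's word (`QCircuitFamily.abstract_codeFP_of_isUniform`), and to chain the `*_codeFP` lemmas of the wire maps
(`embA_codeFP`, `eraseA_fp`, `subA_codeFP`, `tidyA_codeFP`, `stageA_codeFP`, `agAppend`).

Everything here is proved; no named fact is introduced; not the named fact `regev2009_lemma_3_14_stepFamily`.

## References

* O. Regev, *On lattices, learning with errors, random linear codes, and cryptography*, J. ACM 56 (2009),
  art. 34, Lemma 3.14 (proof) [Regev2009].
* S. Arora, B. Barak, *Computational Complexity: A Modern Approach*, CUP 2009, §6.2 and proof of Thm. 6.15
  [AroraBarak2009].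
* M. A. Nielsen, I. L. Chuang, *Quantum Computation and Quantum Information*, CUP 2010, §3.2.5, §4.3, §5.1
  [NielsenChuang2010].
-/

noncomputable section

namespace Literature.Computability.Cryptography.Regev2009.SamplerRegs

open _root_.Computability Literature.Algebra.EuclideanLattices Literature.Algebra.EuclideanLattices.Regev2009
  Literature.Computability.QuantumComplexity Literature.Computability.QuantumComplexity.AJLCore
  SamplerClassical SamplerClassical.Layout SamplerSubst

variable {W : ℕ} (I : LatticeInstance) {Λ : Layout W I.n} (hΛ : Λ.OK)

/-! ### The classical blocks -/

/-- **The branch block `Y ⊕= wordY(X)` abstracts to** the relabelled clean block of the branch machine, its XOR layer,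
and the relabelled clean block reversed. [cite: Regev2009, Lemma 3.14 (proof)] [cite: NielsenChuang2010, §3.2.5 eq. (3.7)] -/
theorem map_toAG_circY (hF : Fits Λ) : (circY hΛ hF).gates.map toAG =
    progA ((RevClean.cleanOps eY MY (I.n * Λ.ℓ + Λ.L) (vY Λ)).map (ClOp.map (CleanPlaced.relabel (I.n * Λ.ℓ + Λ.L) (dposD Λ) Λ.base)) ++
      (CleanXor.xorOpsN eY MY (I.n * Λ.ℓ + Λ.L) (vY Λ) Λ.base (I.n * Λ.ℓY) (fun j => Λ.loc (Λ.oY + j)) ++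
        ((RevClean.cleanOps eY MY (I.n * Λ.ℓ + Λ.L) (vY Λ)).map
          (ClOp.map (CleanPlaced.relabel (I.n * Λ.ℓ + Λ.L) (dposD Λ) Λ.base))).reverse)) :=
  CleanXor.map_toAG_circuit (geomY hΛ hF)

/-- **The residue block `S ⊕= wordS(X)` abstracts** likewise. [cite: Regev2009, Lemma 3.14 (proof)] -/
theorem map_toAG_circS (hF : Fits Λ) : (circS hΛ hF).gates.map toAG =
    progA ((RevClean.cleanOps eS MS (I.n * Λ.ℓ + Λ.L) (vS Λ)).map (ClOp.map (CleanPlaced.relabel (I.n * Λ.ℓ + Λ.L) (dposD Λ) Λ.base)) ++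
      (CleanXor.xorOpsN eS MS (I.n * Λ.ℓ + Λ.L) (vS Λ) Λ.base (I.n * Λ.ℓR) (fun j => Λ.loc (Λ.oS + j)) ++
        ((RevClean.cleanOps eS MS (I.n * Λ.ℓ + Λ.L) (vS Λ)).map
          (ClOp.map (CleanPlaced.relabel (I.n * Λ.ℓ + Λ.L) (dposD Λ) Λ.base))).reverse)) :=
  CleanXor.map_toAG_circuit (geomS hΛ hF)

/-- **The erasing block `X ⊕= wordX(Y, S, A)` abstracts** likewise (data positions `dposX`). [cite: Regev2009, Lemma 3.14 (proof)] -/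
theorem map_toAG_circX (hF : Fits Λ) : (circX hΛ hF).gates.map toAG =
    progA ((RevClean.cleanOps eX MX (Λ.regLen + Λ.L) (vX Λ)).map (ClOp.map (CleanPlaced.relabel (Λ.regLen + Λ.L) (dposX Λ) Λ.base)) ++
      (CleanXor.xorOpsN eX MX (Λ.regLen + Λ.L) (vX Λ) Λ.base (I.n * Λ.ℓ) (fun j => Λ.loc j) ++
        ((RevClean.cleanOps eX MX (Λ.regLen + Λ.L) (vX Λ)).map
          (ClOp.map (CleanPlaced.relabel (Λ.regLen + Λ.L) (dposX Λ) Λ.base))).reverse)) :=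
  CleanXor.map_toAG_circuit (geomX hΛ hF)

/-! ### The whole machine circuit -/

/-- **The abstract gate list of the data-free machine circuit on the standard objects**: GR stage (block words under
`embA 0 ℓ base B i`), erase layer (`eraseA`), oracle stage (`Y ++ S ++ T̂ ++ X ++ T̂` with `T̂` the abstract tidy block of
the solver's word under `subA`), Fourier stage (QFT block words under `embA oS ℓR base qbsize i`).
[cite: Regev2009, Lemma 3.14 (proof)] [cite: AroraBarak2009, §6.2 and proof of Thm. 6.15] -/
theorem map_toAG_machineCircPar_std (hF : Fits Λ) (Rf : UniformQCircuitFamily)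
    (hroomZ : Λ.base + (Λ.kq + Rf.family.ancillas Λ.kq) ≤ W)
    {np wlen kk : ℕ} {ag : Fin Λ.ℓ → (Fin Λ.ℓ → Bool) → ℝ}
    (D : GRBlock.Data (GRData.kit Λ.ℓ np wlen kk) (GRData.ws Λ.ℓ np wlen kk) (GRData.pw Λ.ℓ np wlen kk) ag)
    (hWE : Λ.base + I.n * GRData.B Λ.ℓ np wlen kk ≤ W) {p₀ : ℕ} (hp : p₀ + np ≤ Λ.L) (hE : BlockDisjoint (stdEmb I hΛ hWE))
    (kF : ℕ) (hk : 1 ≤ kF) (hroom : Λ.base + I.n * QFTKit.qbsize Λ.ℓR kF ≤ W) (hloc : ∀ s, Λ.loc s = s) :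
    (machineCircPar I hΛ hF Rf (stdZone Λ hΛ hroomZ) D (stdEmb I hΛ hWE) (srcU I Λ p₀) kF hk hroom).gates.map toAG =
      ((List.finRange I.n).flatMap fun i : Fin I.n =>
          ((GRStage.blockCircuit D).gates.map toAG).map (AGmap (embA 0 Λ.ℓ Λ.base (GRData.B Λ.ℓ np wlen kk) (i : ℕ)))) ++
      (eraseA I.n np (I.n * Λ.ℓ + p₀) Λ.base (GRData.B Λ.ℓ np wlen kk) Λ.ℓ ++
      ((circY hΛ hF).gates.map toAG ++ ((circS hΛ hF).gates.map toAG ++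
        ((TidyBlockFn.tidyA Λ.kq (I.n * Λ.bc) (Rf.family.ancillas Λ.kq) ((Rf.family.circ Λ.kq).gates.map toAG)).map
            (AGmap (subA Λ.Lq Λ.oU Λ.oS Λ.kq (I.n * Λ.bc) Λ.oA Λ.base)) ++
        ((circX hΛ hF).gates.map toAG ++
        ((TidyBlockFn.tidyA Λ.kq (I.n * Λ.bc) (Rf.family.ancillas Λ.kq) ((Rf.family.circ Λ.kq).gates.map toAG)).map
            (AGmap (subA Λ.Lq Λ.oU Λ.oS Λ.kq (I.n * Λ.bc) Λ.oA Λ.base)) ++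
      (List.finRange I.n).flatMap fun i : Fin I.n =>
          ((QFTStage.block (κ := Λ.ℓR) hk).gates.map toAG).map (AGmap (embA Λ.oS Λ.ℓR Λ.base (QFTKit.qbsize Λ.ℓR kF) (i : ℕ))))))))) := by
  have hg : (machineCircPar I hΛ hF Rf (stdZone Λ hΛ hroomZ) D (stdEmb I hΛ hWE) (srcU I Λ p₀) kF hk hroom).gates =
      (GRStage.stageCircuit D (stdEmb I hΛ hWE)).gates ++
        (cnotLayer (GRData.parSrc (stdEmb I hΛ hWE) (srcU I Λ p₀)) (GRData.parList (stdEmb I hΛ hWE))).gates ++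
        (stageCirc hΛ hF (subE hΛ (stdZone Λ hΛ hroomZ)) (TidyBlockFn.tidyCirc (ℓ := I.n * Λ.bc) (Rf.family.circ Λ.kq))).gates ++
        (QFTStage.stageCircuit (qftBlock I hΛ kF hroom) hk).gates := rfl
  rw [hg, List.map_append, List.map_append, List.map_append, map_toAG_grStage_std I hΛ D hWE hloc,
    map_toAG_cnotLayer_par I hΛ hWE hp hE hloc, map_toAG_stageCirc_std hΛ hF hroomZ hloc, TidyBlockFn.map_toAG_tidyCirc,
    map_toAG_qftStage_std I hΛ kF hk hroom hloc]
  simp only [List.append_assoc]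

end Literature.Computability.Cryptography.Regev2009.SamplerRegs

end
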